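import Summits.RiemannHypothesis.RiemannHypothesis.Theorems.SoloInformedCombPacket
import Summits.RiemannHypothesis.RiemannHypothesis.Theorems.SoloInformedSpectralCeiling
import HarnessLib

/-!
# T71 — the geometric side excludes comb pockets above `log h ≍ a e^a`

The comb-pocket theorem T70 (`SoloInformedCombPocket`) prices a pocket from the ZERO side:
under RH a comb packet `g` (T71a, `SoloInformedCombPacket`) in a pocket of radius `R` and width
`u` at height `h` has `Re Q(g) ≤ 2A₁ log(|h|+2) ((1+R²)2a³u² + D) ‖g‖₂²`, `D = C(1+R²)e^{-R/C}`.
Here the GEOMETRIC side of the explicit formula is evaluated on the same packet.  Since its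
spectral mass sits at height `|h|` up to the fraction `D/2`
(`spectral_mass_below_half_le`), Bombieri's one-sided a-priori bound with the archimedean
integral kept (T41, `weilQuadratic_re_ge_ceiling`: `Re ψ(1/4+it/2)` increasing in `|t|`,
`≥ log(1+|t|/2) - C'`; polar and prime terms `≤ L(a) ≤ log π + e^a + 8ae^a`) gives

  `Re Q(g) ≥ (½ log(1 + |h|/4) - K - 9 a e^a) ‖g‖₂²`

(`exists_re_weilQuadratic_ge_of_concentration`) for EVERY window test concentrated at height
`h` in this sense (no hypothesis).  The two bounds are incompatible once `log|h| ≥ A a e^a`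
and `(1+R²)(a³u² + e^{-R/A}) ≤ 1/A`; hence (`exists_zero_off_comb_of_log_height`):

  **RH ⟹ ∃ A > 0: for all `a, τ, h, R, u` with `1 ≤ τ ≤ a-1`, `A ≤ R ≤ |h|/2`, `u ≥ 0`,
  `(1+R²)(a³u² + e^{-R/A}) ≤ 1/A` and `log|h| ≥ A a e^a`, some zero `ζ(1/2+iγ) = 0` with
  `|γ - h| ≤ R` lies at distance `> u` from the comb `h + (π/τ)ℤ`.**

Reading.  Comb pockets (every ordinate of a window of radius `R` within `u ≍ a^{-3/2}R^{-1}` of an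
arithmetic progression of difference `π/τ ≥ π/(a-1)`) are priced by T70 at every height and
EXCLUDED by the trivial prime bound plus the archimedean term from `log|h| ≥ A a e^a` on, i.e.
from `log log|h| ≥ a + log a + O(1)` — the threshold at which Littlewood's scale
`log t/log log t` also begins to forbid them.  Below it (`e^{C₁a} ≤ log|h| ≤ A a e^a`) the
archimedean term is inside the range of the prime sum `Σ_{n ≤ e^{2a}} Λ(n) n^{-1/2-ih} w(n)`
and exclusion would need cancellation in that sum at heights `log|h| ≍ √x`, `x = e^{2a}`:
prime sums of length `(log t)^{2+o(1)}`.
-/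

open Complex Set Filter MeasureTheory Literature.NumberTheory.LFunctions
  Literature.Analysis.SpecialFunctions
open scoped Real Topology

namespace Summit.RiemannHypothesis.RiemannHypothesis.Theorems

/-- **Spectral mass below half the height.** If `(1 + (t-h)²) ‖ĝ(1/2+it)‖² ≤ D ‖g‖₂²` for
`|t - h| ≥ R` and `2R ≤ |h|`, then `∫_{|t| < |h|/2} ‖ĝ(1/2+it)‖² dt ≤ π D ‖g‖₂²`
(on `|t| < |h|/2` one has `|t - h| > |h|/2 ≥ R`, and `∫ dt/(1+(t-h)²) = π`). -/
theorem spectral_mass_below_half_le {g : ℝ → ℂ} (hg : IsWeilTest g) {h R D : ℝ}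
    (hD : 0 ≤ D) (hRh : 2 * R ≤ |h|)
    (hfar : ∀ t : ℝ, R ≤ |t - h| →
      (1 + (t - h) ^ 2) * ‖weilMellin g (1 / 2 + t * I)‖ ^ 2 ≤ D * ∫ x, ‖g x‖ ^ 2) :
    ∫ t in Ioo (-(|h| / 2)) (|h| / 2), ‖weilMellin g (1 / 2 + t * I)‖ ^ 2 ≤
      π * D * ∫ x, ‖g x‖ ^ 2 := by
  obtain ⟨E, hE⟩ : ∃ E : ℝ, E = ∫ x, ‖g x‖ ^ 2 := ⟨_, rfl⟩
  rw [← hE] at hfar ⊢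
  have hE0 : 0 ≤ E := by rw [hE]; exact integral_nonneg fun x ↦ by positivity
  obtain ⟨k, hk⟩ : ∃ k : ℝ → ℝ, k = fun t ↦ D * E * (1 + (t - h) ^ 2)⁻¹ := ⟨_, rfl⟩
  have hki : Integrable k := by
    rw [hk]
    exact (integrable_inv_one_add_sq.comp_sub_right h).const_mul (D * E)
  have hk_int : ∫ t, k t = π * D * E := by
    rw [hk, integral_const_mul, integral_sub_right_eq_self (fun t : ℝ ↦ (1 + t ^ 2)⁻¹) h,
      integral_univ_inv_one_add_sq]
    ring
  have hk0 : ∀ t, 0 ≤ k t := fun t ↦ by rw [hk]; positivity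
  have hle : ∀ t ∈ Ioo (-(|h| / 2)) (|h| / 2),
      ‖weilMellin g (1 / 2 + t * I)‖ ^ 2 ≤ k t := by
    intro t ht
    have h1 : |t| < |h| / 2 := abs_lt.2 ⟨ht.1, ht.2⟩
    have h2 : |h| - |t| ≤ |t - h| := by
      rw [abs_sub_comm t h]
      exact abs_sub_abs_le_abs_sub h t
    have ht' : R ≤ |t - h| := by linarith
    have h3 := hfar t ht'
    rw [hk]
    dsimp only
    rw [← div_eq_mul_inv, le_div_iff₀ (by positivity)]
    linarith
  calc ∫ t in Ioo (-(|h| / 2)) (|h| / 2), ‖weilMellin g (1 / 2 + t * I)‖ ^ 2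
      ≤ ∫ t in Ioo (-(|h| / 2)) (|h| / 2), k t :=
        setIntegral_mono_on (integrable_norm_sq_weilMellin_half_line hg).integrableOn
          hki.integrableOn measurableSet_Ioo hle
    _ ≤ ∫ t, k t := setIntegral_le_integral hki (Eventually.of_forall hk0)
    _ = π * D * E := hk_int

/-- **Archimedean lower bound for window tests concentrated at one height (no hypothesis).**
There is `K ≥ 0` such that every Weil test `g` with `tsupport g ⊆ [-a, a]`, `a ≥ 1`, satisfying
`(1 + (t-h)²) ‖ĝ(1/2+it)‖² ≤ D ‖g‖₂²` for `|t - h| ≥ R`, with `0 ≤ D ≤ 1` and `2R ≤ |h|`, has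
`Re Q(g) ≥ (½ log(1 + |h|/4) - K - 9 a e^a) ‖g‖₂²`: the spectral ceiling T41 at `H = |h|/2`
(`Re Q ≥ (W_H - L(a))‖g‖² - (W_H - ψ(1/4))·(mass below H)`, mass `≤ ‖g‖²/2`), with
`W_H ≥ log(1+|h|/4) - C'` and `L(a) ≤ log π + e^a + 8ae^a`. -/
theorem exists_re_weilQuadratic_ge_of_concentration :
    ∃ K : ℝ, 0 ≤ K ∧ ∀ (g : ℝ → ℂ) (a h R D : ℝ), IsWeilTest g → tsupport g ⊆ Icc (-a) a →
      1 ≤ a → 0 ≤ D → D ≤ 1 → 2 * R ≤ |h| →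
      (∀ t : ℝ, R ≤ |t - h| →
        (1 + (t - h) ^ 2) * ‖weilMellin g (1 / 2 + t * I)‖ ^ 2 ≤ D * ∫ x, ‖g x‖ ^ 2) →
      (Real.log (1 + |h| / 4) / 2 - K - 9 * a * Real.exp a) * ∫ x, ‖g x‖ ^ 2 ≤
        (weilQuadratic g).re := by
  obtain ⟨C', hC'⟩ := exists_log_sub_le_reDigammaQuarter
  refine ⟨|C'| / 2 + |reDigammaQuarter 0| / 2 + |Real.log π|, by positivity,
    fun g a h R D hg hgs ha hD0 hD1 hRh hfar ↦ ?_⟩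
  have hmass := spectral_mass_below_half_le hg hD0 hRh hfar
  have hceil := weilQuadratic_re_ge_ceiling hg hgs (|h| / 2)
  have habs : |(|h| / 2)| = |h| / 2 := abs_of_nonneg (by positivity)
  rw [habs] at hceil
  obtain ⟨E, hE⟩ : ∃ E : ℝ, E = ∫ x, ‖g x‖ ^ 2 := ⟨_, rfl⟩
  rw [← hE] at hmass hceil ⊢
  have hE0 : 0 ≤ E := by rw [hE]; exact integral_nonneg fun x ↦ by positivity
  obtain ⟨W, hW⟩ : ∃ W : ℝ, W = reDigammaQuarter (|h| / 2) := ⟨_, rfl⟩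
  obtain ⟨w₀, hw₀⟩ : ∃ w₀ : ℝ, w₀ = reDigammaQuarter 0 := ⟨_, rfl⟩
  obtain ⟨m, hm⟩ : ∃ m : ℝ,
      m = 1 / (2 * π) * ∫ t in Ioo (-(|h| / 2)) (|h| / 2), ‖weilMellin g (1 / 2 + t * I)‖ ^ 2 :=
    ⟨_, rfl⟩
  rw [← hW, ← hw₀, ← hm] at hceil
  rw [← hw₀]
  have hWw : 0 ≤ W - w₀ := by
    rw [hW, hw₀]
    linarith [reDigammaQuarter_zero_le (|h| / 2)]
  -- the mass term is at most half the energy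
  have hmE : m ≤ E / 2 := by
    rw [hm, div_mul_eq_mul_div, one_mul, div_le_iff₀ (by positivity)]
    calc ∫ t in Ioo (-(|h| / 2)) (|h| / 2), ‖weilMellin g (1 / 2 + t * I)‖ ^ 2
        ≤ π * D * E := hmass
      _ ≤ π * 1 * E := by gcongr
      _ = E / 2 * (2 * π) := by ring
  have hWm : (W - w₀) * m ≤ (W - w₀) * (E / 2) := mul_le_mul_of_nonneg_left hmE hWw
  -- the ceiling height and the ceiling constant
  have hWlo : Real.log (1 + |h| / 4) - C' ≤ W := by
    have h1 := hC' (|h| / 2)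
    rw [habs, show |h| / 2 / 2 = |h| / 4 by ring, ← hW] at h1
    exact h1
  have hL := ceilingConst_le (show 0 < a by linarith)
  have hea : Real.exp a ≤ a * Real.exp a := le_mul_of_one_le_left (Real.exp_pos a).le ha
  have hC'abs : -|C'| ≤ -C' := neg_le_neg (le_abs_self C')
  have hw₀abs : -|w₀| ≤ w₀ := neg_abs_le w₀
  have hπabs : Real.log π ≤ |Real.log π| := le_abs_self _
  have h1 : Real.log (1 + |h| / 4) / 2 - (|C'| / 2 + |w₀| / 2 + |Real.log π|) -
      9 * a * Real.exp a ≤ (W - ceilingConst a) - (W - w₀) / 2 := by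
    linarith
  have h2 := mul_le_mul_of_nonneg_right h1 hE0
  have h3 : ((W - ceilingConst a) - (W - w₀) / 2) * E =
      (W - ceilingConst a) * E - (W - w₀) * (E / 2) := by ring
  rw [h3] at h2
  linarith

/-- **T71. Under RH the geometric side excludes comb pockets above `log|h| ≍ a e^a`.** There is
`A > 0` such that for all `a, τ, h, R, u` with `1 ≤ τ`, `τ + 1 ≤ a`, `A ≤ R`, `2R ≤ |h|`,
`0 ≤ u`, `(1+R²)(a³u² + e^{-R/A}) ≤ 1/A` and `A a e^a ≤ log|h|`, there is an ordinate `γ`,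
`ζ(1/2+iγ) = 0`, with `|γ - h| ≤ R` whose distance from the comb `h + (π/τ)ℤ` exceeds `u`.
Proof: otherwise the comb packet of T71a at `(τ, h, R)` satisfies both
`Re Q(g) ≤ 2A₁ log(|h|+2)((1+R²)2a³u² + D)‖g‖²` (zero side, RH) and
`Re Q(g) ≥ (½log(1+|h|/4) - K - 9ae^a)‖g‖²` (geometric side), which are incompatible. -/
theorem exists_zero_off_comb_of_log_height (hRH : RiemannHypothesis) :
    ∃ A : ℝ, 0 < A ∧ ∀ a τ h R u : ℝ, 1 ≤ τ → τ + 1 ≤ a → A ≤ R → 2 * R ≤ |h| → 0 ≤ u →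
      (1 + R ^ 2) * (a ^ 3 * u ^ 2 + Real.exp (-(R / A))) ≤ 1 / A →
      A * (a * Real.exp a) ≤ Real.log |h| →
      ∃ γ : ℝ, riemannZeta (1 / 2 + γ * I) = 0 ∧ |γ - h| ≤ R ∧
        ∀ k : ℤ, u < |γ - h - k * π / τ| := by
  obtain ⟨C, hC, hpack⟩ := exists_comb_packet
  obtain ⟨A₁, hA₁, hup⟩ := re_weilQuadratic_le_of_combPocket hRH
  obtain ⟨K, hK0, hlow⟩ := exists_re_weilQuadratic_ge_of_concentration
  obtain ⟨K', hK'⟩ : ∃ K' : ℝ, K' = K + Real.log 4 / 2 + Real.log 2 / 8 := ⟨_, rfl⟩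
  obtain ⟨A, hA⟩ : ∃ A : ℝ, A = 16 * A₁ * (2 + C) + C + 3 * |K'| + 27 := ⟨_, rfl⟩
  have h16 : 0 ≤ 16 * A₁ * (2 + C) := by positivity
  have hK'0 : 0 ≤ |K'| := abs_nonneg _
  have hApos : 0 < A := by rw [hA]; positivity
  have hCA : C ≤ A := by rw [hA]; linarith
  have hA27 : 3 * |K'| + 27 ≤ A := by rw [hA]; linarith
  refine ⟨A, hApos, fun a τ h R u hτ hτa hR hRh hu hsmall hheight ↦ ?_⟩
  by_contra hno
  push Not at hno
  have hRC : C ≤ R := hCA.trans hR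
  have ha1 : 1 ≤ a := by linarith
  obtain ⟨g, hgt, hgs1, hEpos, hlat, hfar⟩ := hpack τ h R hτ hRC
  have hgs : tsupport g ⊆ Icc (-a) a :=
    hgs1.trans (Icc_subset_Icc (by linarith) (by linarith))
  -- the concentration constant
  obtain ⟨D, hD⟩ : ∃ D : ℝ, D = C * (1 + R ^ 2) * Real.exp (-(R / C)) := ⟨_, rfl⟩
  have hD0 : 0 ≤ D := by rw [hD]; positivity
  have hexp : Real.exp (-(R / C)) ≤ Real.exp (-(R / A)) := by
    rw [Real.exp_le_exp, neg_le_neg_iff]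
    exact div_le_div_of_nonneg_left (by linarith) hC hCA
  have hsq0 : 0 ≤ (1 + R ^ 2) * (a ^ 3 * u ^ 2) := by positivity
  have hsmall1 : (1 + R ^ 2) * Real.exp (-(R / A)) ≤ 1 / A := by nlinarith
  have hsmall2 : (1 + R ^ 2) * (a ^ 3 * u ^ 2) ≤ 1 / A := by
    nlinarith [Real.exp_pos (-(R / A))]
  have hDle : D ≤ C / A := by
    calc D = C * ((1 + R ^ 2) * Real.exp (-(R / C))) := by rw [hD]; ring
      _ ≤ C * ((1 + R ^ 2) * Real.exp (-(R / A))) := by gcongr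
      _ ≤ C * (1 / A) := by gcongr
      _ = C / A := by ring
  have hD1 : D ≤ 1 := hDle.trans ((div_le_one hApos).2 hCA)
  have hfarD : ∀ t : ℝ, R ≤ |t - h| →
      (1 + (t - h) ^ 2) * ‖weilMellin g (1 / 2 + t * I)‖ ^ 2 ≤ D * ∫ x, ‖g x‖ ^ 2 := by
    intro t ht
    rw [hD]
    exact hfar t ht
  -- the two sides of the explicit formula on the packet
  have hU := hup g a τ h R u D hgt hgs (by linarith) hu hD0 hlat hfarD hno
  have hLo := hlow g a h R D hgt hgs ha1 hD0 hD1 hRh hfarD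
  obtain ⟨E, hE⟩ : ∃ E : ℝ, E = ∫ x, ‖g x‖ ^ 2 := ⟨_, rfl⟩
  rw [← hE] at hU hLo hEpos
  have hcomb : Real.log (1 + |h| / 4) / 2 - K - 9 * a * Real.exp a ≤
      2 * A₁ * Real.log (|h| + 2) * ((1 + R ^ 2) * (2 * a ^ 3 * u ^ 2) + D) :=
    le_of_mul_le_mul_right (hLo.trans hU) hEpos
  -- sizes
  have hae : 6 ≤ a * Real.exp a := by
    have : (3 : ℝ) ≤ Real.exp a := by linarith [Real.add_one_le_exp a]
    nlinarith
  have hP : (3 * |K'| + 27) * (a * Real.exp a) ≤ A * (a * Real.exp a) :=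
    mul_le_mul_of_nonneg_right hA27 (by positivity)
  have hQ' : |K'| * 6 ≤ |K'| * (a * Real.exp a) := mul_le_mul_of_nonneg_left hae hK'0
  have hlogh : 6 * 27 ≤ Real.log |h| := by nlinarith
  have hh1 : 1 < |h| := by
    by_contra hle
    push Not at hle
    have := Real.log_nonpos (abs_nonneg h) hle
    linarith
  have hh0 : 0 < |h| := by linarith
  have hh4 : 4 ≤ |h| := by
    have := Real.log_le_sub_one_of_pos hh0
    linarith
  have hlog1 : Real.log |h| - Real.log 4 ≤ Real.log (1 + |h| / 4) := by
    rw [← Real.log_div hh0.ne' (by norm_num : (4 : ℝ) ≠ 0)]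
    exact Real.log_le_log (by positivity) (by linarith)
  have hlog2 : Real.log (|h| + 2) ≤ Real.log |h| + Real.log 2 := by
    rw [← Real.log_mul hh0.ne' (by norm_num : (2 : ℝ) ≠ 0)]
    exact Real.log_le_log (by positivity) (by linarith)
  have hlog0 : 0 < Real.log (|h| + 2) := Real.log_pos (by linarith)
  -- the zero side is at most `log(|h|+2)/8`
  have hcoef : (1 + R ^ 2) * (2 * a ^ 3 * u ^ 2) + D ≤ (2 + C) / A := by
    have e1 : (1 + R ^ 2) * (2 * a ^ 3 * u ^ 2) = 2 * ((1 + R ^ 2) * (a ^ 3 * u ^ 2)) := by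
      ring
    rw [e1, show (2 + C) / A = 2 * (1 / A) + C / A by ring]
    linarith
  have hB : 2 * A₁ * (2 + C) / A ≤ 1 / 8 := by
    rw [div_le_iff₀ hApos, hA]
    linarith
  have hR1 : 2 * A₁ * Real.log (|h| + 2) * ((1 + R ^ 2) * (2 * a ^ 3 * u ^ 2) + D) ≤
      Real.log (|h| + 2) / 8 := by
    calc 2 * A₁ * Real.log (|h| + 2) * ((1 + R ^ 2) * (2 * a ^ 3 * u ^ 2) + D)
        ≤ 2 * A₁ * Real.log (|h| + 2) * ((2 + C) / A) :=
          mul_le_mul_of_nonneg_left hcoef (by positivity)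
      _ = 2 * A₁ * (2 + C) / A * Real.log (|h| + 2) := by ring
      _ ≤ 1 / 8 * Real.log (|h| + 2) := mul_le_mul_of_nonneg_right hB hlog0.le
      _ = Real.log (|h| + 2) / 8 := by ring
  -- contradiction
  have hK'abs : K' ≤ |K'| := le_abs_self K'
  linarith

end Summit.RiemannHypothesis.RiemannHypothesis.Theorems
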